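import Summits.HodgeConjecture.HodgeConjecture.Theorems.TwistedCyclotomicSelfMapSquareHodgeAbstract

/-!
# TWIST-SEP, III — geometric Level 2 PROVED: `HC⁴(S × S)` for surfaces with a TWISTED-separated cyclotomic self-map (`twistSepSquareHodge_holds`)

Part 3 of 3 (Sketch §A″, ll. 971–1238). Adaptation of the tree's `hodgeEndomorphisms_eq_sum_pullbacks_of_separated` (p577238): the same plumbing on
`T = (Hdg¹)^⊥ ⊂ H²_B(S)`, with the further self-maps `σ_k` (`σ_k^* τ^* = (τ^*)^{t_k} σ_k^*`) restricted to `T` as the Hodge endomorphisms `p_k` of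
TWIST-SEP Level 1; `hodgeEndomorphisms_eq_sum_pullbacks_of_twists` (`End_Hdg(H²(S))` is spanned by pull-backs of the self-map words and divisor
correspondences) and **`twistSepSquareHodge_holds : TwistSepSquareHodge`** (`HC⁴(S × S)` via the tree's SQ-AUT
`PgOneCyclotomicSquares.hodgeConjectureFor_square_of_endomorphisms`). Four `local notation3` (verbatim tree notation `H²[hS]`, `T[hS]`, `Θ[S]`, `τ^[k]`).

PROVENANCE. Cell hodge-nonav (HUMAN RULING D-0038), planner seat p1 g32: chapter ROUTE-P1AE §A (memo `HOME/memos/ROUTE-P1AE.md`),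
frozen Sketch `HOME/p1/route/Sketch_P1AE_GRPSEP_g32.lean` (sha16 38cae48bc3bf4f6b, 1242 lines, namespace `HodgeNonAV.P1AE`, farm rc 0 /
0 sorries / axioms {propext, Classical.choice, Quot.sound}; referee PASS: ref g50, REF-P1AE.md 05a6fdcdc7be5ad5), §A/§A′/§A″ split into three
tree modules `TwistedCyclotomicSelfMapSquareHodgeSemilinear` → `…Abstract` → `TwistedCyclotomicSelfMapSquareHodge` by planner p1 g34 (landing
kit HOME/p1/landing/, 2026-08-28); bodies verbatim (§B of the Sketch is superseded by `Theorems/FermatSurfaceSeparation*` and omitted).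
Extends the K6-landed `Theorems/SeparatedCyclotomicSelfMapSquareHodge{Abstract,}` (p576675 ∕ p577238: CYC-SEP = the case `W = 1`).
Land with `--supports stmt-HodgeConjecture-19652 --as helper`. No instance, no new notation (four `local notation3` of Part 3 are the
tree's, verbatim from `Theorems/SeparatedCyclotomicSelfMapSquareHodge`), no sorry, no new axiom.
HONEST SCOPE: `HC⁴(S × S)` for surfaces `S` with `p_g = 1`-type cyclotomic self-maps whose type table has a non-trivial stabiliser `W`,
GIVEN further self-maps realising the twists — all such `S × S` known to us are dominated by products of curves ∕ Fermat quotients, so this is a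
re-proof engine inside the known region; NOTHING here proves the Hodge conjecture.
References: Green–Griffiths–Kerr, *Mumford–Tate groups and domains* (2012) §V.C [cite: GreenGriffithsKerr2012, §V.C]; T. Shioda, Math. Ann.
245 (1979) Thm II, IV [cite: Shioda1979, Thm. II]; D. Huybrechts, *Lectures on K3 surfaces* (2016) Ch. 3 [cite: Huybrechts2016K3, Ch. 3];
C. Voisin, *Hodge theory I* (2002) §11 [cite: VoisinHodgeI2002, Thm. 11.41].
-/

set_option linter.dupNamespace false

noncomputable section

namespace Summit.HodgeConjecture.HodgeConjecture.Theorems.TwistedCyclotomicSelfMapSquareHodge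

open scoped TensorProduct
open CategoryTheory MonoidalCategory
open Literature.AlgebraicGeometry Literature.AlgebraicGeometry.Motives Literature.AlgebraicGeometry.HodgeTheory
open Literature.AlgebraicTopology.SingularHomology
open Literature.AlgebraicGeometry.Motives.HodgeStructure Literature.AlgebraicGeometry.Surfaces
open Summit.HodgeConjecture.HodgeConjecture.Theorems.PgOneCyclotomicSquares
open Summit.HodgeConjecture.HodgeConjecture.Theorems.SeparatedCyclotomicSelfMapSquareHodge
open Polynomial

/-! ## §A″  TWIST-SEP-2 (geometric Level 2): `HC⁴(S × S)` for surfaces with a TWISTED-separated cyclotomic self-map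

Adaptation of the tree's `hodgeEndomorphisms_eq_sum_pullbacks_of_separated` (p577238): the same plumbing on
`T = (Hdg¹)^⊥`, with the further self-maps `σ k` restricted to `T` as the Hodge endomorphisms `p k` of TWIST-SEP-1. -/

section TwistSepGeometric

open Summit.HodgeConjecture.HodgeConjecture.Theorems.OddPrimeSquares

variable {S : SchemeOver ℂ}

/-- `H²_B(S)` (tree notation, local). -/
local notation3 "H²[" hS "]" =>
  bettiTwoHodgeStructure hS (BettiUniverse.realHodgeModel exists_isReal_hodgeModel_holds hS)
    (BettiUniverse.realHodgeModel_isHodgeSymmetric exists_isReal_hodgeModel_holds hS)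

/-- `T(S)_ℚ = Hdg¹^⊥` (tree notation, local). -/
local notation3 "T[" hS "]" =>
  transcendentalLatticeBetti hS (BettiUniverse.realHodgeModel exists_isReal_hodgeModel_holds hS)
    (BettiUniverse.realHodgeModel_isHodgeSymmetric exists_isReal_hodgeModel_holds hS)

/-- `Θ : ℂ ⊗_ℚ H²(S(ℂ); ℚ) → H²(S(ℂ); ℂ)` (tree notation, local). -/
local notation3 "Θ[" S "]" => ofRatClassBaseChange (Motives.ComplexPoints S) (2 * 1)

/-- `τ^[k]`: the `k`-th power of a self-map in the monoid `End S` (tree notation, local). -/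
local notation3 τ "^[" k "]" => ((CategoryTheory.End.of τ ^ (k : ℕ) : CategoryTheory.End _) : _ ⟶ _)

/-- **TWIST-SEP, Level 2 (geometric).** As the tree's `hodgeEndomorphisms_eq_sum_pullbacks_of_separated`, with the
separation hypothesis replaced by further self-maps `σ k : S ⟶ S` acting on the eigenclasses by
`(σ k)^* ω_{t_k u} = c_{k,u} ω_u` (`c_{k,u} ≠ 0`) whose twist types `t k` cover the stabiliser of the type table up to `1`:
every rational, type-preserving endomorphism `f` of `H²(S(ℂ); ℂ)` with image `⊥ N¹H²` is, on `(N¹H²)^⊥`, a rational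
combination of the `(τ^i)^*` and the `(τ^i ≫ σ_k)^* = (τ^i)^* ∘ σ_k^*`. Proof: TWIST-SEP-1 (`TwistSep.coe_endAlg_mem_span_of_twists`)
on `T = (Hdg¹)^⊥` with `a = τ^*|_T`, `p k = σ_k^*|_T`. [cite: VoisinHodgeI2002, §7.3.1–7.3.2] [cite: Huybrechts2016K3, Ch. 3 Lemma 3.1] -/
theorem hodgeEndomorphisms_eq_sum_pullbacks_of_twists (hS : IsSmoothProjective 2 S)
    (τ : S ⟶ S) {N : ℕ} (hN : 0 < N) {ζ : ℂ} (hζ : IsPrimitiveRoot ζ N)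
    (deg : (ZMod N)ˣ → ℕ) (hdeg : ∀ u, deg u ≤ 2)
    (ω : (ZMod N)ˣ → complexBetti S (2 * 1)) (hω0 : ∀ u, ω u ≠ 0)
    (hωtype : ∀ u, IsOfHodgeType 2 S (2 * 1) (deg u) (2 - deg u) (ω u))
    (hωorth : ∀ u, ∀ d ∈ algebraicClasses S 1, cupProduct (rfl : 2 * 1 + 2 * 1 = 2 * 2) (ω u) d = 0)
    (heig : ∀ u, complexBetti.map τ (2 * 1) (ω u) = ζ ^ (u : ZMod N).val • ω u)
    (hrk : Module.finrank ℂ (algebraicClasses S 1) + Nat.totient N =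
      Module.finrank ℂ (complexBetti S (2 * 1)))
    {K : Type} [Fintype K] (σ : K → (S ⟶ S)) (t : K → (ZMod N)ˣ) (c : K → (ZMod N)ˣ → ℂ)
    (hc0 : ∀ k u, c k u ≠ 0) (hσ : ∀ k u, complexBetti.map (σ k) (2 * 1) (ω (t k * u)) = c k u • ω u)
    (hcover : ∀ w : (ZMod N)ˣ, (∀ u, deg (w * u) = deg u) → w = 1 ∨ ∃ k, t k = w)
    (f : complexBetti S (2 * 1) →ₗ[ℂ] complexBetti S (2 * 1))
    (hf₁ : ∀ y, IsRationalClass y → IsRationalClass (f y))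
    (hf₂ : ∀ (i j : ℕ) y, IsOfHodgeType 2 S (2 * 1) i j y → IsOfHodgeType 2 S (2 * 1) i j (f y))
    (hf₄ : ∀ y : complexBetti S (2 * 1), ∀ d ∈ algebraicClasses S 1,
      cupProduct (rfl : 2 * 1 + 2 * 1 = 2 * 2) (f y) d = 0) :
    ∃ (b : Fin N → ℂ) (b' : K × Fin N → ℂ), ∀ y : complexBetti S (2 * 1),
      (∀ d ∈ algebraicClasses S 1, cupProduct (rfl : 2 * 1 + 2 * 1 = 2 * 2) y d = 0) →
      f y = ∑ i, b i • complexBetti.map (τ^[i]) (2 * 1) y +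
        ∑ ki, b' ki • complexBetti.map (τ^[ki.2] ≫ σ ki.1) (2 * 1) y := by
  haveI : Module.Finite ℚ (bettiCohomology S (2 * 1)) := BettiUniverse.finite hS (2 * 1)
  haveI : NeZero N := ⟨hN.ne'⟩
  have h4 : 2 * 1 + 2 * 1 = 2 * 2 := rfl
  set M := BettiUniverse.realHodgeModel exists_isReal_hodgeModel_holds hS with hMdef
  have hI := hodgePQ_independent_of_hodgeModel_holds
  -- (1) the transcendental sub-Hodge structure `T = (Hdg¹)^⊥`, of rank `φ(N)`
  obtain ⟨T, hT⟩ : ∃ T : SubHodgeStructure (H²[hS]), T.toSubmodule = T[hS] :=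
    exists_subHodgeStructure_orthogonal_hodgeClasses (cupPairingBetti hS) (cupPairingBetti_nondegenerate hS)
      (hodge_F_apply_eq_zero hS)
  have hrkT : Module.finrank ℚ T.toSubmodule = Nat.totient N := by
    rw [hT, finrank_transcendentalLatticeBetti hS]; omega
  -- (2) descend `f` to `g ∈ End_Hdg(H²_B(S))`, with `g(H²) ⊆ T`
  obtain ⟨g, hgofRat, hg⟩ := exists_endAlg_of_hodgeEndomorphism hS f hf₁ hf₂
  have hNcl : ∀ h ∈ (H²[hS]).hodgeClasses 1,
      ofRatClass (Motives.ComplexPoints S) (2 * 1) h ∈ algebraicClasses S 1 := fun h hh ↦ by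
    rw [← map_hodgeClasses_baseChange_eq_algebraicClasses hS]
    exact ⟨(1 : ℂ) ⊗ₜ h, Submodule.tmul_mem_baseChange_of_mem 1 hh, by rw [ofRatClassBaseChange_tmul, one_smul]⟩
  have hmemT : ∀ v : bettiCohomology S (2 * 1),
      (∀ d ∈ algebraicClasses S 1,
        cupProduct h4 (ofRatClass (Motives.ComplexPoints S) (2 * 1) v) d = 0) → v ∈ T.toSubmodule := by
    intro v hv
    rw [hT, mem_transcendentalLatticeBetti_iff]
    intro h hh
    rw [cupPairingBetti_apply]
    have hc : cupProduct (X := Motives.ComplexPoints S) (R := ℚ) h4 h v = 0 := by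
      apply ofRatClass_injective (Y := Motives.ComplexPoints S) (2 * 2)
      rw [map_zero, ofRatClass_eq_ringChange, singularCohomology.ringChange_cupProduct,
        ← ofRatClass_eq_ringChange, ← ofRatClass_eq_ringChange,
        cupProduct_gradedComm_holds ℂ (Motives.ComplexPoints S) h4 h4, hv _ (hNcl h hh), smul_zero]
    rw [hc, map_zero]
  have hgT : ∀ v, (g : Module.End ℚ (bettiCohomology S (2 * 1))) v ∈ T.toSubmodule := fun v ↦
    hmemT _ fun d hd ↦ by rw [hgofRat]; exact hf₄ _ d hd
  set g' : T.toHodgeStructure.endAlg :=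
    ⟨(((endAlg.toHom g).comp T.subtypeHom).codRestrict T fun w ↦ hgT (w : bettiCohomology S (2 * 1))).toLinearMap,
      Hom.toLinearMap_mem_endAlg _⟩ with hg'def
  have hg' : ∀ w : T.toSubmodule, (((g' : Module.End ℚ T.toSubmodule) w : T.toSubmodule) :
      bettiCohomology S (2 * 1)) = (g : Module.End ℚ (bettiCohomology S (2 * 1))) w := fun w ↦ rfl
  -- (3) the eigenclasses lift to `T_ℂ` and span it
  have hlift : ∀ u, ∃ x : ℂ ⊗[ℚ] T.toSubmodule, Θ[S] (T.toSubmodule.subtype.baseChange ℂ x) = ω u :=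
    fun u ↦ exists_baseChange_eq_of_orthogonal hS hT (hωorth u)
  choose ωT hωT using hlift
  have hμ : Function.Injective fun u : (ZMod N)ˣ ↦ ζ ^ (u : ZMod N).val := pow_val_injective hζ
  have hliω : LinearIndependent ℂ ω :=
    Module.End.eigenvectors_linearIndependent' (complexBetti.map τ (2 * 1)).hom _ hμ ω fun u ↦
      ⟨Module.End.mem_eigenspace_iff.2 (heig u), hω0 u⟩
  have hliT : LinearIndependent ℂ ωT := by
    refine LinearIndependent.of_comp ((Θ[S]) ∘ₗ T.toSubmodule.subtype.baseChange ℂ) ?_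
    have e : ⇑((Θ[S]) ∘ₗ T.toSubmodule.subtype.baseChange ℂ) ∘ ωT = ω := funext fun u ↦ hωT u
    rw [e]
    exact hliω
  have hcardT : Fintype.card (ZMod N)ˣ = Module.finrank ℂ (ℂ ⊗[ℚ] T.toSubmodule) := by
    rw [ZMod.card_units_eq_totient, Module.finrank_baseChange, hrkT]
  have hspanT : Submodule.span ℂ (Set.range ωT) = ⊤ := hliT.span_eq_top_of_card_eq_finrank' hcardT
  -- the further self-maps act on the eigenclasses: `σ_k^* ω_v = c_{k, t_k⁻¹ v} ω_{t_k⁻¹ v}`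
  have hσω : ∀ k v, complexBetti.map (σ k) (2 * 1) (ω v) = c k ((t k)⁻¹ * v) • ω ((t k)⁻¹ * v) := by
    intro k v
    have := hσ k ((t k)⁻¹ * v)
    rwa [mul_inv_cancel_left] at this
  -- (4) `τ^*` and the `σ_k^*` preserve `T`
  have hTC : ∀ x : ℂ ⊗[ℚ] T.toSubmodule, ∀ d ∈ algebraicClasses S 1,
      cupProduct h4 (complexBetti.map τ (2 * 1) (Θ[S] (T.toSubmodule.subtype.baseChange ℂ x))) d = 0 := by
    intro x d hd
    have hx : x ∈ Submodule.span ℂ (Set.range ωT) := by rw [hspanT]; exact Submodule.mem_top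
    obtain ⟨e, rfl⟩ := (Submodule.mem_span_range_iff_exists_fun ℂ).1 hx
    simp only [map_sum, map_smul, hωT, heig, LinearMap.sum_apply, LinearMap.smul_apply,
      fun u ↦ hωorth u d hd, smul_zero, Finset.sum_const_zero]
  have hTCσ : ∀ k, ∀ x : ℂ ⊗[ℚ] T.toSubmodule, ∀ d ∈ algebraicClasses S 1,
      cupProduct h4 (complexBetti.map (σ k) (2 * 1) (Θ[S] (T.toSubmodule.subtype.baseChange ℂ x))) d = 0 := by
    intro k x d hd
    have hx : x ∈ Submodule.span ℂ (Set.range ωT) := by rw [hspanT]; exact Submodule.mem_top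
    obtain ⟨e, rfl⟩ := (Submodule.mem_span_range_iff_exists_fun ℂ).1 hx
    simp only [map_sum, map_smul, hωT, hσω, LinearMap.sum_apply, LinearMap.smul_apply,
      fun u ↦ hωorth u d hd, smul_zero, Finset.sum_const_zero]
  -- restriction of a pull-back to `T`
  have hres : ∀ (φ : S ⟶ S),
      (∀ x : ℂ ⊗[ℚ] T.toSubmodule, ∀ d ∈ algebraicClasses S 1,
        cupProduct h4 (complexBetti.map φ (2 * 1) (Θ[S] (T.toSubmodule.subtype.baseChange ℂ x))) d = 0) →
      ∃ aφ : T.toHodgeStructure.endAlg, ∀ w : T.toSubmodule,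
        (((aφ : Module.End ℚ T.toSubmodule) w : T.toSubmodule) : bettiCohomology S (2 * 1)) =
          bettiCohomology.map φ (2 * 1) (w : bettiCohomology S (2 * 1)) := by
    intro φ hφC
    set gφ : (H²[hS]).endAlg :=
      ⟨(BettiUniverse.pullHodgeHom exists_isReal_hodgeModel_holds hodgePQ_independent_of_hodgeModel_holds hS hS φ
          (2 * 1)).toLinearMap, Hom.toLinearMap_mem_endAlg _⟩ with hgφdef
    have hgφ : ∀ v, (gφ : Module.End ℚ (bettiCohomology S (2 * 1))) v = bettiCohomology.map φ (2 * 1) v := by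
      intro v
      show (BettiUniverse.pullHodgeHom exists_isReal_hodgeModel_holds hodgePQ_independent_of_hodgeModel_holds hS hS φ
        (2 * 1)).toLinearMap v = _
      rw [BettiUniverse.pullHodgeHom_toLinearMap]
    have hφT : ∀ w ∈ T.toSubmodule, (gφ : Module.End ℚ (bettiCohomology S (2 * 1))) w ∈ T.toSubmodule := by
      intro w hw
      apply hmemT
      intro d hd
      rw [hgφ, ← map_ofRatClass]
      have := hφC ((1 : ℂ) ⊗ₜ[ℚ] (⟨w, hw⟩ : T.toSubmodule)) d hd
      rwa [LinearMap.baseChange_tmul, ofRatClassBaseChange_tmul, one_smul, Submodule.subtype_apply] at this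
    exact ⟨⟨(((endAlg.toHom gφ).comp T.subtypeHom).codRestrict T fun w ↦ hφT _ w.2).toLinearMap,
      Hom.toLinearMap_mem_endAlg _⟩, fun w ↦ hgφ w⟩
  obtain ⟨a, ha⟩ := hres τ hTC
  have hp' : ∀ k, ∃ pk : T.toHodgeStructure.endAlg, ∀ w : T.toSubmodule,
      (((pk : Module.End ℚ T.toSubmodule) w : T.toSubmodule) : bettiCohomology S (2 * 1)) =
        bettiCohomology.map (σ k) (2 * 1) (w : bettiCohomology S (2 * 1)) := fun k ↦ hres (σ k) (hTCσ k)
  choose p hp using hp'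
  -- (5) eigen-data on `T_ℂ`
  have hΘι_inj : Function.Injective fun x : ℂ ⊗[ℚ] T.toSubmodule ↦
      Θ[S] (T.toSubmodule.subtype.baseChange ℂ x) :=
    (ofRatClassBaseChange_injective (Motives.ComplexPoints S) (2 * 1)).comp
      (baseChange_injective_of_injective T.toSubmodule.injective_subtype)
  have hωT0 : ∀ u, ωT u ≠ 0 := fun u h0 ↦ hω0 u (by rw [← hωT u, h0, map_zero, map_zero])
  have heigT : ∀ u, ((a : Module.End ℚ T.toSubmodule).baseChange ℂ) (ωT u) = ζ ^ (u : ZMod N).val • ωT u := by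
    intro u
    apply hΘι_inj
    show Θ[S] (T.toSubmodule.subtype.baseChange ℂ _) = Θ[S] (T.toSubmodule.subtype.baseChange ℂ _)
    rw [← map_ofRatClassBaseChange_subtype hS τ a ha, hωT, heig, map_smul, map_smul, hωT]
  have hpT : ∀ k u, ((p k : Module.End ℚ T.toSubmodule).baseChange ℂ) (ωT (t k * u)) = c k u • ωT u := by
    intro k u
    apply hΘι_inj
    show Θ[S] (T.toSubmodule.subtype.baseChange ℂ _) = Θ[S] (T.toSubmodule.subtype.baseChange ℂ _)
    rw [← map_ofRatClassBaseChange_subtype hS (σ k) (p k) (hp k), hωT, hσ, map_smul, map_smul, hωT]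
  have hp0 : ∀ k, (p k : Module.End ℚ T.toSubmodule) ≠ 0 := by
    intro k h0
    have h1 := hpT k 1
    rw [h0, LinearMap.baseChange_zero, LinearMap.zero_apply] at h1
    exact hωT0 1 ((smul_eq_zero.1 h1.symm).resolve_left (hc0 k 1))
  have hpt : ∀ k, (p k : Module.End ℚ T.toSubmodule) * (a : Module.End ℚ T.toSubmodule) =
      (a : Module.End ℚ T.toSubmodule) ^ ((t k : ZMod N).val) * (p k : Module.End ℚ T.toSubmodule) := by
    intro k
    refine sub_eq_zero.1 (eq_zero_of_baseChange_apply_eq_zero ωT hspanT _ fun v ↦ ?_)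
    have hv : v = t k * ((t k)⁻¹ * v) := (mul_inv_cancel_left (t k) v).symm
    rw [LinearMap.baseChange_sub, LinearMap.sub_apply, sub_eq_zero, LinearMap.baseChange_mul, LinearMap.baseChange_mul,
      Module.End.mul_apply, Module.End.mul_apply, heigT, map_smul, hv, hpT, map_smul,
      TwistSep.baseChange_pow_apply_eigen heigT, ← pow_val_mul hζ ((t k)⁻¹ * v) (t k), smul_smul, smul_smul,
      mul_comm ((t k)⁻¹ * v) (t k), mul_comm (c k _)]
  -- Hodge levels of the lifted eigenclasses
  have hpiece : ∀ u, T.toSubmodule.subtype.baseChange ℂ (ωT u) ∈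
      (H²[hS]).piece (deg u : ℤ) ((2 - deg u : ℕ) : ℤ) := by
    intro u
    rw [cast_piece, HodgeModel.piece_eq_ratPiece _ _ _ (show deg u + (2 - deg u) = 2 * 1 by have := hdeg u; omega),
      HodgeModel.mem_ratPiece_iff, HodgeModel.complexification_apply, hωT]
    obtain ⟨B, hB⟩ := hωtype u
    exact hI 2 S hS B M (2 * 1) _ _ _ hB
  have hF : ∀ u, ωT u ∈ T.toHodgeStructure.F (deg u : ℤ) := fun u ↦
    (H²[hS]).piece_le_F _ _ (hpiece u)
  have hnF : ∀ u, ωT u ∉ T.toHodgeStructure.F ((deg u : ℤ) + 1) := by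
    intro u hu
    have ha' : T.toSubmodule.subtype.baseChange ℂ (ωT u) ∈ (H²[hS]).F ((deg u : ℤ) + 1) := hu
    have hb := (H²[hS]).piece_le_complexConj_F _ _ (hpiece u)
    have hc : T.toSubmodule.subtype.baseChange ℂ (ωT u) ∈
        (H²[hS]).F ((deg u : ℤ) + 1) ⊓ complexConj ((H²[hS]).F ((2 - deg u : ℕ) : ℤ)) := ⟨ha', hb⟩
    rw [((H²[hS]).isCompl_F_complexConj _ _ (by have := hdeg u; omega)).inf_eq_bot, Submodule.mem_bot] at hc
    exact hωT0 u (baseChange_injective_of_injective T.toSubmodule.injective_subtype (by rw [hc, map_zero]))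
  -- (6) TWIST-SEP-1 on `T`
  have hmem := TwistSep.coe_endAlg_mem_span_of_twists a hN hζ (fun u ↦ (deg u : ℤ)) ωT hωT0
      hF hnF heigT hrkT p t hp0 hpt (fun w hw ↦ hcover w fun u ↦ by exact_mod_cast hw u) g'
  rw [Submodule.span_union, Submodule.mem_sup] at hmem
  obtain ⟨y₁, hy₁, y₂, hy₂, hsum⟩ := hmem
  obtain ⟨b, hb⟩ := (Submodule.mem_span_range_iff_exists_fun ℚ).1 hy₁
  obtain ⟨b', hb'⟩ := (Submodule.mem_span_range_iff_exists_fun ℚ).1 hy₂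
  have hstar : ∀ w : T.toSubmodule, (g : Module.End ℚ (bettiCohomology S (2 * 1))) w =
      ∑ i : Fin N, b i • bettiCohomology.map (τ^[i]) (2 * 1) (w : bettiCohomology S (2 * 1)) +
        ∑ ki : K × Fin N, b' ki • bettiCohomology.map (τ^[ki.2] ≫ σ ki.1) (2 * 1) (w : bettiCohomology S (2 * 1)) := by
    intro w
    rw [← hg' w, ← hsum, ← hb, ← hb']
    simp only [LinearMap.add_apply, LinearMap.sum_apply, LinearMap.smul_apply, Submodule.coe_add, Submodule.coe_sum,
      Submodule.coe_smul]
    congr 1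
    · refine Finset.sum_congr rfl fun i _ ↦ ?_
      rw [← SubmonoidClass.coe_pow, coe_pow_apply_eq_map_pow hS τ a ha]
    · refine Finset.sum_congr rfl fun ki _ ↦ ?_
      rw [Module.End.mul_apply, bettiCohomology.map_comp, ModuleCat.comp_apply, ← hp ki.1, ← SubmonoidClass.coe_pow,
        coe_pow_apply_eq_map_pow hS τ a ha]
  -- (7) conclusion on `(N¹H²)^⊥ = Θ(T_ℂ)`
  refine ⟨fun i ↦ (b i : ℂ), fun ki ↦ (b' ki : ℂ), fun y hy ↦ ?_⟩
  obtain ⟨u, rfl⟩ := exists_baseChange_eq_of_orthogonal hS hT hy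
  clear hy
  induction u using TensorProduct.induction_on with
  | zero => simp only [map_zero, smul_zero, Finset.sum_const_zero, add_zero]
  | tmul c' w =>
    rw [LinearMap.baseChange_tmul, ofRatClassBaseChange_tmul, Submodule.subtype_apply, map_smul, ← hgofRat,
      hstar w, map_add, map_sum, map_sum, smul_add, Finset.smul_sum, Finset.smul_sum]
    congr 1
    · refine Finset.sum_congr rfl fun k _ ↦ ?_
      rw [Motives.ofRatClass_smul, map_smul, map_ofRatClass, smul_comm]
    · refine Finset.sum_congr rfl fun k _ ↦ ?_
      rw [Motives.ofRatClass_smul, map_smul, map_ofRatClass, smul_comm]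
  | add x y hx hy =>
    rw [map_add, map_add, map_add, hx, hy, add_add_add_comm, ← Finset.sum_add_distrib, ← Finset.sum_add_distrib]
    congr 1
    · refine Finset.sum_congr rfl fun k _ ↦ ?_
      rw [map_add, smul_add]
    · refine Finset.sum_congr rfl fun k _ ↦ ?_
      rw [map_add, smul_add]

/-- **KERNEL — rung «TWIST-SEP» ⇒ `HC⁴(S × S)`** (`TwistSepSquareHodge` holds): TWIST-SEP-2
(`hodgeEndomorphisms_eq_sum_pullbacks_of_twists`) feeds SQ-AUT (`hodgeConjectureFor_square_of_endomorphisms`, the graphs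
of self-maps are algebraic self-correspondences) with the finite family `{τ^i} ∪ {τ^i ≫ σ_k}` enumerated by `Fin m`.
CYC-SEP (`hodgeConjectureFor_square_of_separatedCyclotomicSelfMap`, p577238) is the case `K = ∅`. It does not prove the
Hodge conjecture: it is a mechanism for `HC⁴(S × S)` for surfaces carrying a cyclotomic self-map whose type stabiliser is
realised by further self-maps (customers: memo ROUTE-P1AE §C). [cite: VoisinHodgeI2002, §11.3.3] [cite: Shioda1979, Thm. II] -/
theorem twistSepSquareHodge_holds : TwistSepSquareHodge := by
  intro S hS τ N hN ζ hζ deg hdeg ω hω0 hωtype hωorth heig hrk K _ σ t c hc0 hσ hcover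
  classical
  set F : Fin N ⊕ (K × Fin N) → (S ⟶ S) :=
    Sum.elim (fun i : Fin N ↦ τ^[i]) (fun ki : K × Fin N ↦ τ^[ki.2] ≫ σ ki.1) with hFdef
  set e := Fintype.equivFin (Fin N ⊕ (K × Fin N)) with hedef
  refine hodgeConjectureFor_square_of_endomorphisms hS (fun j ↦ F (e.symm j)) fun f hf₁ hf₂ _hf₃ hf₄ ↦ ?_
  obtain ⟨b, b', hbb'⟩ := hodgeEndomorphisms_eq_sum_pullbacks_of_twists hS τ hN hζ deg hdeg ω hω0 hωtype hωorth
    heig hrk σ t c hc0 hσ hcover f hf₁ hf₂ hf₄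
  refine ⟨0, fun j ↦ Sum.elim b b' (e.symm j), fun y hy ↦ ?_⟩
  rw [zero_smul, zero_add, hbb' y hy]
  exact (Fintype.sum_sum_type (fun x ↦ Sum.elim b b' x • complexBetti.map (F x) (2 * 1) y)).symm.trans
    (Equiv.sum_comp e.symm (fun x ↦ Sum.elim b b' x • complexBetti.map (F x) (2 * 1) y)).symm

end TwistSepGeometric

end Summit.HodgeConjecture.HodgeConjecture.Theorems.TwistedCyclotomicSelfMapSquareHodge

end
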